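import Summits.HodgeConjecture.CorCM.IrreducibleOddWeightsCanonicalPivotCMFields
import Mathlib.FieldTheory.LinearDisjoint
import HarnessLib

/-!
# Canonical pivot, VI: FIELD-THEORETIC CRITERIA — `Hg(A₀ × A₁) = Hg(A₀) × Hg(A₁)` for ALL CM types as soon as the trace
# of the Galois closure of `K₁` on `K₀` lies in the maximal real subfield `K₀⁺` (in particular when `K₀ ⊗_ℚ L₁` is a field)

COR-CM (cell `pub-hodgecm2`, binder seat `b16` gen 65, count-neutral claim CANONICAL PIVOT, file C7 — CM fields and
realisations; theorems only, no definition, no named fact, no `sorry`).  NEW as stated, hence under `Summits/`.  HONEST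
FRAMING: unconditional statements about `dim MT(A₀ × A₁)` for abelian varieties with complex multiplication, read from
the two CM FIELDS alone (no condition on the types); no Hodge class is claimed algebraic beyond the tree's nondegenerate
case; `HC_CM` is neither used nor asserted.

File C2 (`IrreducibleOddWeightsCanonicalPivotCMFields`) proved: if for every embedding `a : K_{i₀} → ℂ` the elements of
the TRACE `a(K_{i₀}) ∩ L₁` (`L₁ = normalClosure ℚ K_{i₁} ℂ`) are real, then `Hg(A₀ × A₁) = Hg(A₀) × Hg(A₁)` for every
pair of CM types.  This file states that hypothesis in the currencies a census seat meets:

* **`cmFamilyRank_add_card_eq_pair_of_forall_mem_maximalRealSubfield`** — INTRINSIC FORM: the trace field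
  `a⁻¹(L₁) ⊆ K_{i₀}` lies in Mathlib's MAXIMAL REAL SUBFIELD `K_{i₀}⁺ = maximalRealSubfield K_{i₀}` (for a CM field:
  the fixed field of complex conjugation).  Realisations: `forall_hodgeClassesProductSpan_pair_of_forall_mem_maximalRealSubfield`
  (no mixed exceptional classes on any `A₀^a × A₁^b`), `isNondegenerateFamily_iff_forall_of_forall_mem_maximalRealSubfield`,
  `hodgeConjectureFor_prod_of_forall_mem_maximalRealSubfield` (nondegenerate types: HC on every `A₀^a × A₁^b`).
* **`cmFamilyRank_add_card_eq_pair_of_forall_fieldRange_inf_normalClosure_eq_bot`** — TRIVIAL TRACE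
  `a(K_{i₀}) ∩ L₁ = ℚ`; **`…_of_forall_linearDisjoint`** — `a(K_{i₀})` and `L₁` LINEARLY DISJOINT over `ℚ`
  (`K_{i₀} ⊗_ℚ L₁` a field; Mathlib `IntermediateField.LinearDisjoint`), **`…_of_forall_finrank_sup_eq_mul`** — the
  DEGREE form `[a(K_{i₀})·L₁ : ℚ] = [K_{i₀} : ℚ]·[L₁ : ℚ]`.  The tree's `LinearlyDisjointCMFieldsHodge` needs the Galois
  CLOSURE `L₀` linearly disjoint from `L₁`; here only `K_{i₀}` itself — e.g. a non-normal `K_{i₀}` whose closure meets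
  `L₁` in a CM field not touching `K_{i₀}`.

## References

* [Gordon1999HodgeAVSurvey] B. B. Gordon, *A survey of the Hodge conjecture for abelian varieties*, §3 Theorem (Imai,
  Murty) with proof, 7.5–7.7, 10.10.
* [MoonenZarhin1999LowDim] B. Moonen, Yu. Zarhin, Math. Ann. 315 (1999), Thm. (0.2), §3 (3.1).
* [Lang2002] S. Lang, *Algebra*, 3rd ed., VI §1 Thm. 1.12 and Thm. 1.14, VIII §3–§4 (linear disjointness).
* [Shimura1998] G. Shimura, *Abelian Varieties with Complex Multiplication and Modular Functions*, §18.2 Lemma (i).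
-/

set_option autoImplicit false

noncomputable section

open scoped BigOperators Classical

open CategoryTheory CategoryTheory.Limits NumberField Module IntermediateField

namespace Summit.HodgeConjecture.CorCM

open Literature.NumberTheory.ComplexMultiplication
open Literature.AlgebraicGeometry.Motives (AbelianVariety CMType)
open Literature.AlgebraicGeometry.Motives.AbelianVariety
open Literature.AlgebraicGeometry.HodgeTheory
open Literature.AlgebraicGeometry.ComplexMultiplication (IsCMTypeRealisation)
open Literature.AlgebraicGeometry.Pohlmann1968

variable {I : Type} [Fintype I] {K : I → Type} [∀ i, Field (K i)] [∀ i, NumberField (K i)] [∀ i, IsCMField (K i)]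

/-! ### §1 The trace inside the maximal real subfield -/

omit [Fintype I] [∀ i, NumberField (K i)] [∀ i, IsCMField (K i)] in
/-- An element of the maximal real subfield has real images under every complex embedding (Mathlib's definition).
[cite: Shimura1998, §18.2 Lemma (i)] -/
theorem conj_apply_eq_of_mem_maximalRealSubfield {i₀ : I} {k : K i₀} (hk : k ∈ maximalRealSubfield (K i₀))
    (a : K i₀ →+* ℂ) : starRingEnd ℂ (a k) = a k := by
  rw [starRingEnd_apply]
  exact (mem_maximalRealSubfield_iff k).1 hk a

/-- **THE TRACE IN `K₀⁺` ⟹ `Hg(A₀ × A₁) = Hg(A₀) × Hg(A₁)` FOR ALL TYPES.**  If for every embedding `a : K_{i₀} → ℂ` the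
trace field `a⁻¹(L₁)` lies in the maximal real subfield of `K_{i₀}`, then `cmFamilyRank Φ + 2 = cmTypeRank Φ₀ +
cmTypeRank Φ₁ + 1` for every pair of CM types. [cite: Gordon1999HodgeAVSurvey, §3 Theorem (proof) and 7.5–7.7]
[cite: MoonenZarhin1999LowDim, Thm. (0.2)] -/
theorem cmFamilyRank_add_card_eq_pair_of_forall_mem_maximalRealSubfield {i₀ i₁ : I} (h01 : i₀ ≠ i₁)
    (hI : ∀ l, l = i₀ ∨ l = i₁) (Φ : ∀ i, CMType (K i))
    (htr : ∀ (a : K i₀ →+* ℂ) (k : K i₀), a k ∈ normalClosure ℚ (K i₁) ℂ → k ∈ maximalRealSubfield (K i₀)) :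
    CMAlgebra.cmFamilyRank Φ + Fintype.card I = (∑ i, cmTypeRank (Φ i)) + 1 :=
  cmFamilyRank_add_card_eq_pair_of_forall_conj_apply_eq h01 hI Φ fun a k hk =>
    conj_apply_eq_of_mem_maximalRealSubfield (htr a k hk) a

/-- … then the pair is nondegenerate iff both members are. [cite: Gordon1999HodgeAVSurvey, 7.5–7.6.1] -/
theorem isNondegenerateFamily_iff_forall_of_forall_mem_maximalRealSubfield {i₀ i₁ : I} (h01 : i₀ ≠ i₁)
    (hI : ∀ l, l = i₀ ∨ l = i₁) (Φ : ∀ i, CMType (K i))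
    (htr : ∀ (a : K i₀ →+* ℂ) (k : K i₀), a k ∈ normalClosure ℚ (K i₁) ℂ → k ∈ maximalRealSubfield (K i₀)) :
    CMAlgebra.IsNondegenerateFamily Φ ↔ ∀ i, IsNondegenerate (Φ i) :=
  isNondegenerateFamily_iff_forall_of_forall_conj_apply_eq h01 hI Φ fun a k hk =>
    conj_apply_eq_of_mem_maximalRealSubfield (htr a k hk) a

section Hodge

variable {Φ : ∀ i, CMType (K i)} {A : I → AbelianVariety ℂ} {ιA : ∀ i, 𝓞 (K i) →+* End (A i)}
  {θ : ∀ i, K i →+* Module.End ℂ (complexBetti (A i).X 1)}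

/-- … and every rational Hodge class on every `A₀^a × A₁^b` (disjoint slot maps) is a `ℂ`-combination of exterior
products of rational Hodge classes of the factors. [cite: MoonenZarhin1999LowDim, §3 (3.1)] -/
theorem forall_hodgeClassesProductSpan_pair_of_forall_mem_maximalRealSubfield {i₀ i₁ : I} (h01 : i₀ ≠ i₁)
    (hI : ∀ l, l = i₀ ∨ l = i₁)
    (htr : ∀ (a : K i₀ →+* ℂ) (k : K i₀), a k ∈ normalClosure ℚ (K i₁) ℂ → k ∈ maximalRealSubfield (K i₀))
    (hA : ∀ i, IsCMTypeRealisation (Φ i) (A i) (ιA i) (θ i)) (N₁ N₂ : ℕ) [NeZero N₁] [NeZero N₂] (π₁ : Fin N₁ → I)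
    (π₂ : Fin N₂ → I) (hdisj : ∀ l₁ l₂, π₁ l₁ ≠ π₂ l₂) :
    HodgeClassesProductSpan (⨁ fun l => A (π₁ l)) (⨁ fun l => A (π₂ l)) :=
  forall_hodgeClassesProductSpan_pair_of_forall_conj_apply_eq h01 hI
    (fun a k hk => conj_apply_eq_of_mem_maximalRealSubfield (htr a k hk) a) hA N₁ N₂ π₁ π₂ hdisj

/-- … and for nondegenerate `Φ₀`, `Φ₁` every `A₀^a × A₁^b` satisfies the Hodge conjecture, unconditionally.
[cite: Gordon1999HodgeAVSurvey, 10.10 and 7.5] -/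
theorem hodgeConjectureFor_prod_of_forall_mem_maximalRealSubfield {i₀ i₁ : I} (h01 : i₀ ≠ i₁)
    (hI : ∀ l, l = i₀ ∨ l = i₁)
    (htr : ∀ (a : K i₀ →+* ℂ) (k : K i₀), a k ∈ normalClosure ℚ (K i₁) ℂ → k ∈ maximalRealSubfield (K i₀))
    (hnd : ∀ i, IsNondegenerate (Φ i)) (hA : ∀ i, IsCMTypeRealisation (Φ i) (A i) (ιA i) (θ i)) {N : ℕ}
    (π : Fin N → I) :
    HodgeConjectureFor (⨁ fun l : Fin N => A (π l)).dim (⨁ fun l : Fin N => A (π l)).X :=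
  hodgeConjectureFor_prod_of_forall_conj_apply_eq h01 hI
    (fun a k hk => conj_apply_eq_of_mem_maximalRealSubfield (htr a k hk) a) hnd hA π

end Hodge

/-! ### §2 Trivial trace: intersection, linear disjointness, degree -/

/-- **TRIVIAL TRACE `a(K₀) ∩ L₁ = ℚ` (as intermediate fields of `ℂ`) ⟹ `Hg(A₀ × A₁) = Hg(A₀) × Hg(A₁)` for all types.**
[cite: Gordon1999HodgeAVSurvey, §3 Theorem (proof) and 7.5–7.7] [cite: Lang2002, VI §1 Thm. 1.12] -/
theorem cmFamilyRank_add_card_eq_pair_of_forall_fieldRange_inf_normalClosure_eq_bot {i₀ i₁ : I} (h01 : i₀ ≠ i₁)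
    (hI : ∀ l, l = i₀ ∨ l = i₁) (Φ : ∀ i, CMType (K i))
    (hbot : ∀ a : K i₀ →+* ℂ, a.toRatAlgHom.fieldRange ⊓ normalClosure ℚ (K i₁) ℂ = ⊥) :
    CMAlgebra.cmFamilyRank Φ + Fintype.card I = (∑ i, cmTypeRank (Φ i)) + 1 :=
  cmFamilyRank_add_card_eq_pair_of_forall_mem_bot h01 hI Φ fun a k hk => by
    rw [← hbot a]
    exact ⟨AlgHom.mem_fieldRange.2 ⟨k, rfl⟩, hk⟩

/-- **`a(K₀)` and `L₁` LINEARLY DISJOINT over `ℚ` (i.e. `K₀ ⊗_ℚ L₁` is a field) ⟹ `Hg(A₀ × A₁) = Hg(A₀) × Hg(A₁)` for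
all types** — only `K₀` itself, not its Galois closure, has to be disjoint from `L₁`.
[cite: Lang2002, VIII §3–§4 and VI §1 Thm. 1.14] [cite: Gordon1999HodgeAVSurvey, §3 Theorem (proof)] -/
theorem cmFamilyRank_add_card_eq_pair_of_forall_linearDisjoint {i₀ i₁ : I} (h01 : i₀ ≠ i₁) (hI : ∀ l, l = i₀ ∨ l = i₁)
    (Φ : ∀ i, CMType (K i))
    (hld : ∀ a : K i₀ →+* ℂ, (a.toRatAlgHom.fieldRange).LinearDisjoint (normalClosure ℚ (K i₁) ℂ)) :
    CMAlgebra.cmFamilyRank Φ + Fintype.card I = (∑ i, cmTypeRank (Φ i)) + 1 :=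
  cmFamilyRank_add_card_eq_pair_of_forall_fieldRange_inf_normalClosure_eq_bot h01 hI Φ fun a => (hld a).inf_eq_bot

/-- **DEGREE FORM: `[a(K₀)·L₁ : ℚ] = [K₀ : ℚ]·[L₁ : ℚ]` for every embedding `a` ⟹ `Hg(A₀ × A₁) = Hg(A₀) × Hg(A₁)` for all
types.** [cite: Lang2002, VIII §3–§4] [cite: Gordon1999HodgeAVSurvey, §3 Theorem (proof)] -/
theorem cmFamilyRank_add_card_eq_pair_of_forall_finrank_sup_eq_mul {i₀ i₁ : I} (h01 : i₀ ≠ i₁)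
    (hI : ∀ l, l = i₀ ∨ l = i₁) (Φ : ∀ i, CMType (K i))
    (hdeg : ∀ a : K i₀ →+* ℂ, finrank ℚ ↥(a.toRatAlgHom.fieldRange ⊔ normalClosure ℚ (K i₁) ℂ) =
      finrank ℚ (K i₀) * finrank ℚ ↥(normalClosure ℚ (K i₁) ℂ)) :
    CMAlgebra.cmFamilyRank Φ + Fintype.card I = (∑ i, cmTypeRank (Φ i)) + 1 := by
  refine cmFamilyRank_add_card_eq_pair_of_forall_linearDisjoint h01 hI Φ fun a => ?_
  haveI : FiniteDimensional ℚ (a.toRatAlgHom).fieldRange :=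
    LinearEquiv.finiteDimensional (AlgEquiv.ofInjectiveField a.toRatAlgHom).toLinearEquiv
  refine IntermediateField.LinearDisjoint.of_finrank_sup ?_
  have e : finrank ℚ (K i₀) = finrank ℚ ↥(a.toRatAlgHom).fieldRange :=
    (AlgEquiv.ofInjectiveField a.toRatAlgHom).toLinearEquiv.finrank_eq
  rw [hdeg a, e]

end Summit.HodgeConjecture.CorCM

end
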